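import Literature.AnabelianGeometry.SemiGraphs.TieBijectiveGeneral
import Literature.AnabelianGeometry.SemiGraphs.CoverticialRemark241OfGeneralTie

/-!
# Print's finite étale coverings of semi-graphs of anabelioids compose — no connectedness hypotheses
# ([SemiAnbd] Def. 2.2 (i) p. 23, Rmk. 2.4.1 / 2.4.2 p. 26)

Mochizuki, *Semi-graphs of anabelioids*, Publ. RIMS **42** (2006) 221–322, §2, Def. 2.2 (i) p. 23 and
Remark 2.4.1 p. 26 (whose universally sub-coverticial clause uses: the composite of finite étale
coverings is a finite étale covering) [cite: MochizukiSemiAnbd2006, Rem. 2.4.1 p.26].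

PROOF-ONLY (abc-iut cell, layer L3; FACT-LIST row F-1478; seat abc-iut-f-161).  abc-iut-w5-d041's
`Hom.IsFiniteEtaleCoveringGlobal.comp_of_connected` (`FiniteEtaleCoveringCompConnected`) composed print's
finite étale coverings of CONNECTED semi-graphs of anabelioids, connectedness entering only through
abc-iut-f-161's tie.  With the tie now available for arbitrary semi-graphs (`Hom.tie_bijective_general`),
the same assembly (`Hom.IsFiniteEtaleCoveringOf.comp_of_tieLabels`, `Hom.isFiniteEtaleCoveringGlobal_comp_of_local`)
gives the unconditional statements:

* `Hom.IsFiniteEtaleCoveringOf.comp` — the LOCAL clause of a composite `φ.comp ψ` (for `ψ` locally the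
  covering of `A` with a global witness, branch- and vertex-aligned, `φ` locally the covering of `B`);
* `Hom.IsFiniteEtaleCoveringGlobal.comp` — **print's finite étale coverings (local ∧ global ∧
  branch-aligned ∧ vertex-aligned) are closed under composition**, for ALL semi-graphs of anabelioids.

Nothing here takes a side on [IUTchIII] Cor. 3.12; typed ≠ proved.
-/

namespace Literature.AnabelianGeometry.SemiGraphs

namespace SemiGraphOfAnabelioids

open CategoryTheory CategoryTheory.Limits

universe v₁ u₁ u

variable {𝒢 ℋ 𝒦 : SemiGraphOfAnabelioids.{v₁, u₁, u}}

/-- **The LOCAL clause of a composite** ([SemiAnbd] Def. 2.2 (i) under Rmk. 2.4.2), no connectedness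
hypotheses: for `φ : 𝒢 → ℋ` locally the covering of `B ∈ B(ℋ)` and `ψ : ℋ → 𝒦` locally the covering of
`A ∈ B(𝒦)`, branch- and vertex-aligned, with a global witness `αψ : B(𝒦)_{/A} ⥲ B(ℋ)`,
`e_ψ : ψ^* ≅ (A × −) ⋙ αψ`, the composite `φ.comp ψ` is locally the covering of `(αψ⁻¹ B).left`
(abc-iut-w5-d041's `comp_of_tieLabels` fed with `tie_bijective_general`).
[cite: MochizukiSemiAnbd2006, Def. 2.2(i) p.23] -/
theorem Hom.IsFiniteEtaleCoveringOf.comp {φ : Hom 𝒢 ℋ} {ψ : Hom ℋ 𝒦} {B : ℋ.BObj} {A : 𝒦.BObj}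
    (hφ : φ.IsFiniteEtaleCoveringOf B) (hψ : ψ.IsFiniteEtaleCoveringOf A) (hal : ψ.IsBranchAligned)
    (hva : ψ.IsVertexAligned) [HasBinaryProducts 𝒦.BObj] (αψ : Over A ⥤ ℋ.BObj) [αψ.IsEquivalence]
    (eψ : ψ.pullbackFunctor ≅ Over.star A ⋙ αψ) :
    (φ.comp ψ).IsFiniteEtaleCoveringOf (αψ.inv.obj B).left :=
  Hom.IsFiniteEtaleCoveringOf.comp_of_tieLabels hφ hψ hal hva αψ eψ (by
    obtain ⟨O, OE, h1, h2, h3, h4, -⟩ := Hom.tie_bijective_general ψ A αψ eψ hψ hal hva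
    exact ⟨O, OE, h1, h2, h3, h4⟩)

/-- **Print's finite étale coverings of semi-graphs of anabelioids compose** ([SemiAnbd] Def. 2.2 (i),
Rmk. 2.4.1 / 2.4.2), no connectedness hypotheses: if `ψ : 𝒢″ → 𝒢′` and `φ : 𝒢′ → 𝒢` are finite étale
coverings in print's sense (local ∧ global ∧ branch-aligned ∧ vertex-aligned, `IsFiniteEtaleCoveringGlobal`),
so is `ψ.comp φ` (abc-iut-w5-d041's `isFiniteEtaleCoveringGlobal_comp_of_local` with the local clause
`Hom.IsFiniteEtaleCoveringOf.comp`). [cite: MochizukiSemiAnbd2006, Rem. 2.4.1 p.26] -/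
theorem Hom.IsFiniteEtaleCoveringGlobal.comp {𝒢 𝒢' 𝒢'' : SemiGraphOfAnabelioids.{v₁, u₁, u}}
    {ψ : Hom 𝒢'' 𝒢'} {φ : Hom 𝒢' 𝒢} (hψ : ψ.IsFiniteEtaleCoveringGlobal)
    (hφ : φ.IsFiniteEtaleCoveringGlobal) : (ψ.comp φ).IsFiniteEtaleCoveringGlobal :=
  Hom.isFiniteEtaleCoveringGlobal_comp_of_local
    (fun _ _ _ _ hψl _ _ _ hφl hφb hφv _ α _ e => Hom.IsFiniteEtaleCoveringOf.comp hψl hφl hφb hφv α e)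
    hψ hφ

end SemiGraphOfAnabelioids

end Literature.AnabelianGeometry.SemiGraphs
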